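import Summits.BirchSwinnertonDyer.Rank1Residual.GaloisImage.KolyvaginPrimeTorsionCount
import Summits.BirchSwinnertonDyer.Rank1Residual.GaloisImage.UnipotentShapeKernel
import Literature.NumberTheory.EllipticCurves.TorsionStructureProofs
import Literature.NumberTheory.GaloisRepresentations.AbsIntegersEquiv
import Literature.NumberTheory.GaloisCohomology.KolyvaginSystems
import Literature.NumberTheory.GaloisRepresentations.CyclotomicLevels
import Summits.BirchSwinnertonDyer.Rank1Residual.GaloisImage.EisensteinPrimeInProgression
import HarnessLib

/-!
# A Kolyvagin prime of Kim's `𝒫_K` with the cyclicity flag is a Frobenius-class prime of Sakamoto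
# (bridge B1, curve half, file B1-frob; cell `b2b-bsdres`, team n1011, ROUTE-1 item R1-23; seat p18)

HONEST FRAMING (verbatim for the cell): research route on the CONSTRUCTION-SHAPED class `X4` /
N11; prove what is provable now; nothing booked; no mark / label moved.  TOOL theorems only — no
definition, no named fact.

## What is proved

For `E/ℚ` (globally minimal `W`), a prime `p`, `K ≥ 1`, and a prime `ℓ ≠ p` of good reduction with
`ℓ ≡ 1 (mod p^K)`, `p^K ∣ #Ẽ(𝔽_ℓ)` (Kim's `ℓ ∈ 𝒫_K`, [K22] §1.2.2) and the CYCLICITY FLAG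
`#Ẽ_v(k_v)[p] ≤ p`:

* `exists_frobenius_shape` — there is an arithmetic Frobenius `σ₀` at `v ∣ ℓ` which fixes `μ_{p^K}`
  and satisfies Sakamoto's (H.2): `E[p^K]/(σ₀ − 1) ≃ ℤ/p^K` (kernel data from
  `FrobShape.exists_frobenius_kernel_data`, shape from `Unipotent.…_of_ker` with the Weil pairing);
* `mem_frobeniusClassPrimes_of_kolyvaginPrime` — if moreover `ρ_{E,p^K}` is onto `Aut(E[p^K])` and
  `τ ∈ Gal(ℚ̄/ℚ(μ_{p^K}))` satisfies (H.2), then `v ∈ frobeniusClassPrimes ρ S τ (p^K)` for every `S`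
  avoiding `v` (`Unipotent.exists_addEquiv_conj_of_sq_eq_zero`: `ρ(Frob_v)` and `ρ(τ)` are conjugate
  by some `ρ(g)`, and `g Frob g⁻¹` is again a Frobenius at `v`);
* the `ℤ`-modulus spellings `…'` (`n = p^K` as an integer, e.g. `3^k · 3`) for the N11 instances.

References: R. Sakamoto, Math. Ann. (2024) §2, (H.2) and the set `𝒫` [Sakamoto2024]; C.-H. Kim,
AJM 148 (2026) §1.2.2 [Kim2022StructureSelmer]; J. H. Silverman, *AEC* (2009) III.8.1, VII.3.1(b),
VII.4.1(a) [SilvermanAEC2009]; J.-P. Serre, *Abelian ℓ-adic representations* I.1.2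
[SerreAbelianLadic1968].
-/

noncomputable section

open scoped Classical Pointwise
open NumberField IsDedekindDomain IsDedekindDomain.HeightOneSpectrum Field WeierstrassCurve
open Literature.NumberTheory.EllipticCurves Literature.NumberTheory.GaloisRepresentations
open Literature.NumberTheory.GaloisCohomology Rat.HeightOneSpectrum

namespace Summit.BirchSwinnertonDyer.Rank1Residual.GaloisImage.FrobShape

/-! ## The Weil pairing on `E[N]` is invariant under `Gal(ℚ̄/ℚ(μ_N))` -/

/-- **An invariant non-degenerate alternating pairing on `E[N]`**: the Weil pairing `e_N`
(Silverman III.8.1, the tree's `exists_weilPairing_holds`) is preserved by every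
`g ∈ Gal(ℚ̄/ℚ(μ_N))` acting through `ρ_{E,N}` (Galois equivariance + values in `μ_N`).
[cite: SilvermanAEC2009, Prop. III.8.1] -/
theorem exists_invariant_pairing (W : WeierstrassCurve ℚ) [W.IsElliptic] (N : ℕ) (hN : 2 ≤ N) :
    ∃ e : geomTorsion W (N : ℕ) → geomTorsion W (N : ℕ) → AlgebraicClosure ℚ,
      (∀ S T, e S T ^ N = 1) ∧ (∀ S₁ S₂ T, e (S₁ + S₂) T = e S₁ T * e S₂ T) ∧
      (∀ S T₁ T₂, e S (T₁ + T₂) = e S T₁ * e S T₂) ∧ (∀ T, e T T = 1) ∧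
      (∀ T, (∀ S, e S T = 1) → T = 0) ∧
      ∀ g ∈ rootsOfUnityFixer ℚ N, ∀ S T,
        e ((galoisRepTorsion W N g).toAdd S) ((galoisRepTorsion W N g).toAdd T) = e S T := by
  have hN0 : (N : ℚ) ≠ 0 := by exact_mod_cast (show N ≠ 0 by omega)
  obtain ⟨e, hpow, haddl, haddr, halt, hnd, hgal⟩ := exists_weilPairing_holds W N hN hN0
  refine ⟨e, hpow, haddl, haddr, halt, hnd, fun g hg S T => ?_⟩
  rw [galoisRepTorsion_apply, galoisRepTorsion_apply, ← hgal]
  exact (mem_rootsOfUnityFixer_iff.mp hg) _ (hpow S T)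

/-- **A Frobenius at `ℓ ≡ 1 (mod p^K)` fixes `μ_{p^K}`** (`χ(Frob_v) = N v = ℓ`,
`smul_eq_pow_residueCard_of_isArithFrobAt`). [cite: SerreAbelianLadic1968, Ch. I §1.2] -/
theorem mem_rootsOfUnityFixer_of_isArithFrobAt {p ℓ : ℕ} [Fact p.Prime]
    (hℓ : ℓ.Prime) {v : HeightOneSpectrum (𝓞 ℚ)} (hv : (ℓ : 𝓞 ℚ) ∈ v.asIdeal)
    (hpv : (p : 𝓞 ℚ) ∉ v.asIdeal) {K : ℕ} (hK : 0 < K) (hℓ1 : ℓ ≡ 1 [MOD p ^ K])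
    {𝔓 : Ideal (absIntegers (𝓞 ℚ) ℚ)} (h𝔓 : 𝔓 ∈ v.primesAbove) {σ : absoluteGaloisGroup ℚ}
    (hσ : IsArithFrobAt (𝓞 ℚ) σ 𝔓) : σ ∈ rootsOfUnityFixer ℚ (p ^ K) := by
  refine mem_rootsOfUnityFixer_iff.mpr fun t ht => ?_
  rw [smul_eq_pow_residueCard_of_isArithFrobAt hpv h𝔓 hσ ht, residueCard_eq_of_natCast_mem hℓ hv]
  have hp1 : 1 < p ^ K := Nat.one_lt_pow hK.ne' (Fact.out : p.Prime).one_lt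
  have hmod : ℓ % p ^ K = 1 := by
    rw [hℓ1, Nat.mod_eq_of_lt hp1]
  conv_lhs => rw [← Nat.div_add_mod ℓ (p ^ K), hmod, pow_add, pow_mul, ht, one_pow, one_mul, pow_one]

/-! ## The Frobenius at a Kolyvagin prime has Sakamoto's shape (H.2) -/

/-- The kernel of `ρ(σ) − 1` on `E[N]` is the fixed-point set of `σ`. [folklore] -/
theorem natCard_ker_sub_id_eq (W : WeierstrassCurve ℚ) [W.IsElliptic] (N : ℕ)
    (σ : absoluteGaloisGroup ℚ) :
    Nat.card ((galoisRepTorsion W N σ).toAdd.toAddMonoidHom -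
        AddMonoidHom.id (geomTorsion W (N : ℕ))).ker =
      Nat.card {P : geomTorsion W (N : ℕ) // σ • P = P} := by
  refine Nat.card_congr (Equiv.subtypeEquivRight fun P => ?_)
  rw [AddMonoidHom.mem_ker, AddMonoidHom.sub_apply, sub_eq_zero]
  rfl

/-- **The Frobenius at a Kolyvagin prime has Sakamoto's shape.**  `E/ℚ` (globally minimal `W`),
primes `ℓ ≠ p`, `ℓ` good, `v ∣ ℓ`, `K ≥ 1`, `ℓ ≡ 1 (mod p^K)`, `p^K ∣ #Ẽ(𝔽_ℓ)` and the cyclicity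
flag `#Ẽ_v(k_v)[p] ≤ p`: there is an arithmetic Frobenius `σ₀` at a prime above `v`, fixing
`μ_{p^K}`, with `(ρ(σ₀) − 1)² = 0` on `E[p^K]`, a value of `ρ(σ₀) − 1` of order `p^K`, and (H.2)
`E[p^K]/(σ₀ − 1) ≃ ℤ/p^K` — so `σ₀` may serve as Sakamoto's `τ` at level `p^K`.
[cite: Sakamoto2024, §2 (H.2) (p. 921)] [cite: Kim2022StructureSelmer, §1.2.2]
[cite: SilvermanAEC2009, Prop. III.8.1 and Prop. VII.3.1(b)] -/
theorem exists_frobenius_shape (W : WeierstrassCurve ℚ) [W.IsElliptic] [W.IsGloballyMinimal]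
    (p ℓ : ℕ) [hp : Fact p.Prime] [Fact ℓ.Prime] (hℓp : ℓ ≠ p)
    (hgoodℓ : W.HasGoodReductionAtPrime ℓ) {v : HeightOneSpectrum (𝓞 ℚ)}
    (hv : (ℓ : 𝓞 ℚ) ∈ v.asIdeal) {K : ℕ} (hK : 0 < K) (hℓ1 : ℓ ≡ 1 [MOD p ^ K])
    (hflag : Nat.card (AddSubgroup.torsionBy (W.reductionAt v).toAffine.Point (p : ℕ)) ≤ p)
    (hdvd : p ^ K ∣ W.reductionPointCount ℓ) :
    ∃ (σ₀ : absoluteGaloisGroup ℚ) (𝔓₀ : Ideal (absIntegers (𝓞 ℚ) ℚ)),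
      𝔓₀ ∈ v.primesAbove ∧ IsArithFrobAt (𝓞 ℚ) σ₀ 𝔓₀ ∧ σ₀ ∈ rootsOfUnityFixer ℚ (p ^ K) ∧
      (∀ P : geomTorsion W (p ^ K : ℕ), σ₀ • (σ₀ • P - P) - (σ₀ • P - P) = 0) ∧
      (∃ w : geomTorsion W (p ^ K : ℕ), addOrderOf (σ₀ • w - w) = p ^ K) ∧
      Nonempty (cokerSubOne (W.torsionGaloisModule ((p ^ K : ℕ) : ℤ)) σ₀ ≃+ ZMod (p ^ K)) := by
  have hℓ : ℓ.Prime := Fact.out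
  have hvℓ : (primesEquiv v : ℕ) = ℓ := primesEquiv_eq_of_natCast_mem hℓ hv
  have hpv : (p : 𝓞 ℚ) ∉ v.asIdeal := fun h ↦
    hℓp (hvℓ.symm.trans (primesEquiv_eq_of_natCast_mem hp.out h))
  obtain ⟨σ₀, 𝔓₀, h𝔓₀, hσ₀, hker, R, hR⟩ :=
    exists_frobenius_kernel_data W p ℓ hℓp hgoodℓ hv hK hflag hdvd
  have hσ₀μ : σ₀ ∈ rootsOfUnityFixer ℚ (p ^ K) :=
    mem_rootsOfUnityFixer_of_isArithFrobAt hℓ hv hpv hK hℓ1 h𝔓₀ hσ₀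
  -- the module `E[p^K]`, its frame and its Weil pairing
  have h2 : 2 ≤ p ^ K := le_trans hp.out.two_le (Nat.le_self_pow hK.ne' p)
  have hN0 : ((p ^ K : ℕ) : ℚ) ≠ 0 := by exact_mod_cast pow_ne_zero K hp.out.ne_zero
  obtain ⟨F⟩ := nonempty_geomTorsion_addEquiv_prod W hN0
  haveI : Finite (geomTorsion W (p ^ K : ℕ)) := Finite.of_equiv _ F.symm.toEquiv
  obtain ⟨e, hpow, haddl, haddr, halt, hnd, hinv⟩ := exists_invariant_pairing W (p ^ K) h2
  set u₀ : geomTorsion W (p ^ K : ℕ) ≃+ geomTorsion W (p ^ K : ℕ) :=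
    (galoisRepTorsion W (p ^ K : ℕ) σ₀).toAdd with hu₀
  have hkerU : Nat.card (u₀.toAddMonoidHom - AddMonoidHom.id _).ker = p ^ K := by
    rw [hu₀, natCard_ker_sub_id_eq, hker]
  have hmove : ∃ w, p ^ (K - 1) • (u₀ w - w) ≠ 0 := ⟨R, hR⟩
  obtain ⟨hsq, w, hw⟩ := Unipotent.sq_eq_zero_and_exists_addOrderOf_eq_of_ker hK F.symm u₀ hkerU
    hmove e hpow haddl haddr halt hnd (hinv σ₀ hσ₀μ)
  have hco := Unipotent.nonempty_coker_addEquiv_zmod_of_ker hK F.symm u₀ hkerU hmove e hpow haddl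
    haddr halt hnd (hinv σ₀ hσ₀μ)
  refine ⟨σ₀, 𝔓₀, h𝔓₀, hσ₀, hσ₀μ, fun P => hsq P, ⟨w, hw⟩, ?_⟩
  have heq : (W.torsionGaloisModule ((p ^ K : ℕ) : ℤ) σ₀).toAddMonoidHom = u₀.toAddMonoidHom :=
    AddMonoidHom.ext fun P => rfl
  change Nonempty (geomTorsion W (p ^ K : ℕ) ⧸
    ((W.torsionGaloisModule ((p ^ K : ℕ) : ℤ) σ₀).toAddMonoidHom - AddMonoidHom.id _).range ≃+ _)
  rw [heq]
  exact hco

/-! ## Membership in Sakamoto's `τ`-class -/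

/-- **A Kolyvagin prime of Kim's `𝒫_K` with the cyclicity flag lies in Sakamoto's `τ`-class.**
`E/ℚ` (globally minimal `W`), primes `ℓ ≠ p`, `ℓ` good, `v ∣ ℓ`, `K ≥ 1`, `ℓ ≡ 1 (mod p^K)`,
`p^K ∣ #Ẽ(𝔽_ℓ)`, `#Ẽ_v(k_v)[p] ≤ p`, `ρ_{E,p^K}` ONTO `Aut(E[p^K])`, and `τ ∈ Gal(ℚ̄/ℚ(μ_{p^K}))`
with (H.2) `E[p^K]/(τ − 1) ≃ ℤ/p^K`: then `v ∈ frobeniusClassPrimes ρ_{E,p^K} S τ (p^K)` for every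
`S ∌ v` — `ρ(Frob_v)` and `ρ(τ)` have the same shape, hence are conjugate by some `ρ(g)`
(`Unipotent.exists_addEquiv_conj_of_sq_eq_zero`), and `g Frob_v g⁻¹` is a Frobenius at `v` acting as
`τ` on `E[p^K]` and on `μ_{p^K}`. [cite: Sakamoto2024, §2, the set 𝒫 and (H.2) (pp. 920–921)]
[cite: Kim2022StructureSelmer, §1.2.2] [cite: SilvermanAEC2009, Prop. VII.4.1(a)] -/
theorem mem_frobeniusClassPrimes_of_kolyvaginPrime (W : WeierstrassCurve ℚ) [W.IsElliptic]
    [W.IsGloballyMinimal] (p ℓ : ℕ) [hp : Fact p.Prime] [Fact ℓ.Prime] (hℓp : ℓ ≠ p)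
    (hgoodℓ : W.HasGoodReductionAtPrime ℓ) {v : HeightOneSpectrum (𝓞 ℚ)}
    (hv : (ℓ : 𝓞 ℚ) ∈ v.asIdeal) {K : ℕ} (hK : 0 < K) (hℓ1 : ℓ ≡ 1 [MOD p ^ K])
    (hflag : Nat.card (AddSubgroup.torsionBy (W.reductionAt v).toAffine.Point (p : ℕ)) ≤ p)
    (hdvd : p ^ K ∣ W.reductionPointCount ℓ)
    (hsurj : W.HasSurjectiveModNGaloisRep ((p ^ K : ℕ) : ℤ))
    {τ : absoluteGaloisGroup ℚ} (hτμ : τ ∈ rootsOfUnityFixer ℚ (p ^ K))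
    (hτq : Nonempty (cokerSubOne (W.torsionGaloisModule ((p ^ K : ℕ) : ℤ)) τ ≃+ ZMod (p ^ K)))
    {S : Set (HeightOneSpectrum (𝓞 ℚ))} (hvS : v ∉ S) :
    v ∈ frobeniusClassPrimes (W.torsionGaloisModule ((p ^ K : ℕ) : ℤ)) S τ (p ^ K) := by
  have hℓ : ℓ.Prime := Fact.out
  have hvℓ : (primesEquiv v : ℕ) = ℓ := primesEquiv_eq_of_natCast_mem hℓ hv
  have hgood : W.HasGoodReductionAt v :=
    (hasGoodReductionAtPrime_primesEquiv_iff_holds W v ℓ hvℓ).mp hgoodℓ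
  have hpv : (p : 𝓞 ℚ) ∉ v.asIdeal := fun h ↦
    hℓp (hvℓ.symm.trans (primesEquiv_eq_of_natCast_mem hp.out h))
  obtain ⟨σ₀, 𝔓₀, h𝔓₀, hσ₀, hσ₀μ, hsq₀, ⟨w₀, hw₀⟩, -⟩ :=
    exists_frobenius_shape W p ℓ hℓp hgoodℓ hv hK hℓ1 hflag hdvd
  -- the module, its frame and the Weil pairing
  have h2 : 2 ≤ p ^ K := le_trans hp.out.two_le (Nat.le_self_pow hK.ne' p)
  have hN0 : ((p ^ K : ℕ) : ℚ) ≠ 0 := by exact_mod_cast pow_ne_zero K hp.out.ne_zero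
  obtain ⟨F⟩ := nonempty_geomTorsion_addEquiv_prod W hN0
  haveI : Finite (geomTorsion W (p ^ K : ℕ)) := Finite.of_equiv _ F.symm.toEquiv
  obtain ⟨e, hpow, haddl, haddr, halt, hnd, hinv⟩ := exists_invariant_pairing W (p ^ K) h2
  -- the shape of `τ` from (H.2)
  set uτ : geomTorsion W (p ^ K : ℕ) ≃+ geomTorsion W (p ^ K : ℕ) :=
    (galoisRepTorsion W (p ^ K : ℕ) τ).toAdd with huτ
  have hτq' : Nonempty (geomTorsion W (p ^ K : ℕ) ⧸
      (uτ.toAddMonoidHom - AddMonoidHom.id _).range ≃+ ZMod (p ^ K)) := by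
    have heq : (W.torsionGaloisModule ((p ^ K : ℕ) : ℤ) τ).toAddMonoidHom = uτ.toAddMonoidHom :=
      AddMonoidHom.ext fun P => rfl
    rw [← heq]
    exact hτq
  obtain ⟨hsqτ, wτ, hwτ⟩ := Unipotent.sq_eq_zero_and_exists_addOrderOf_eq hK F.symm uτ hτq' e hpow
    haddl haddr halt hnd (hinv τ hτμ)
  -- the shape of `σ₀`, in the same currency
  set u₀ : geomTorsion W (p ^ K : ℕ) ≃+ geomTorsion W (p ^ K : ℕ) :=
    (galoisRepTorsion W (p ^ K : ℕ) σ₀).toAdd with hu₀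
  have hsq₀' : ∀ P, (u₀.toAddMonoidHom - AddMonoidHom.id (geomTorsion W (p ^ K : ℕ)))
      ((u₀.toAddMonoidHom - AddMonoidHom.id (geomTorsion W (p ^ K : ℕ))) P) = 0 := hsq₀
  have hw₀' : addOrderOf ((u₀.toAddMonoidHom - AddMonoidHom.id (geomTorsion W (p ^ K : ℕ))) w₀) =
      p ^ K := hw₀
  -- conjugacy `γ u₀ = uτ γ`, realised by `g ∈ Γ_ℚ`
  obtain ⟨hNv, hcardV⟩ := Unipotent.nsmul_eq_zero_and_card_of_frame F.symm
  obtain ⟨γ, hγ⟩ := Unipotent.exists_addEquiv_conj_of_sq_eq_zero hcardV hNv _ _ hsq₀' hsqτ hw₀' hwτ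
  have hγ' : ∀ P : geomTorsion W (p ^ K : ℕ), γ (σ₀ • P) = τ • γ P := fun P => by
    have h := hγ P
    change γ (σ₀ • P - P) = τ • γ P - γ P at h
    rw [map_sub] at h
    exact sub_left_injective h
  obtain ⟨g, hg⟩ := hsurj (Multiplicative.ofAdd γ)
  have hgP : ∀ P : geomTorsion W (p ^ K : ℕ), g • P = γ P := fun P => by
    rw [← galoisRepTorsion_apply, hg]; rfl
  have hginv : ∀ P : geomTorsion W (p ^ K : ℕ), g⁻¹ • P = γ.symm P := fun P => by
    rw [inv_smul_eq_iff, hgP, AddEquiv.apply_symm_apply]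
  -- the Frobenius `σ := g σ₀ g⁻¹`
  refine ⟨hvS, v.natCast_pow_not_mem hpv K, ?_, g * σ₀ * g⁻¹, ⟨g • 𝔓₀, smul_mem_primesAbove h𝔓₀ g,
    hσ₀.conj g⟩, ?_, ?_⟩
  · -- `E[p^K]` is unramified at the good place `v ∤ p`
    intro 𝔓 h𝔓 σ hσI
    refine LinearMap.ext fun P => ?_
    rw [torsionGaloisModule_apply_apply]
    exact W.smul_geomTorsion_eq_of_mem_inertia hgood
      (by rw [Int.cast_natCast]; exact v.natCast_pow_not_mem hpv K) h𝔓 hσI P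
  · -- `σ τ⁻¹` acts trivially on `E[p^K]`
    intro P
    rw [torsionGaloisModule_apply_apply, mul_smul, mul_smul, mul_smul, hginv, hgP, hγ',
      AddEquiv.apply_symm_apply, smul_inv_smul]
  · -- `σ τ⁻¹` fixes `μ_{p^K}`
    intro ζ hζ
    have hτ' : τ⁻¹ • ζ = ζ :=
      (mem_rootsOfUnityFixer_iff.mp ((rootsOfUnityFixer ℚ (p ^ K)).inv_mem hτμ)) ζ hζ
    have hζ' : (g⁻¹ • ζ) ^ (p ^ K) = 1 := by rw [← smul_pow', hζ, smul_one]
    rw [mul_smul, hτ', mul_smul, mul_smul, (mem_rootsOfUnityFixer_iff.mp hσ₀μ) _ hζ', smul_inv_smul]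

/-- **`ℤ`-modulus spelling** of `mem_frobeniusClassPrimes_of_kolyvaginPrime` (for the N11
instances, whose module is `E[n]` with `n = 3^k · 3 : ℤ`). [cite: Sakamoto2024, §2 (pp. 920–921)] -/
theorem mem_frobeniusClassPrimes_of_kolyvaginPrime' (W : WeierstrassCurve ℚ) [W.IsElliptic]
    [W.IsGloballyMinimal] (p ℓ : ℕ) [Fact p.Prime] [Fact ℓ.Prime] (hℓp : ℓ ≠ p)
    (hgoodℓ : W.HasGoodReductionAtPrime ℓ) {v : HeightOneSpectrum (𝓞 ℚ)}
    (hv : (ℓ : 𝓞 ℚ) ∈ v.asIdeal) {K : ℕ} (hK : 0 < K) (hℓ1 : ℓ ≡ 1 [MOD p ^ K])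
    (hflag : Nat.card (AddSubgroup.torsionBy (W.reductionAt v).toAffine.Point (p : ℕ)) ≤ p)
    (hdvd : p ^ K ∣ W.reductionPointCount ℓ) (n : ℤ) (hn : n = ((p ^ K : ℕ) : ℤ))
    (hsurj : W.HasSurjectiveModNGaloisRep n)
    {τ : absoluteGaloisGroup ℚ} (hτμ : τ ∈ rootsOfUnityFixer ℚ (p ^ K))
    (hτq : Nonempty (cokerSubOne (W.torsionGaloisModule n) τ ≃+ ZMod (p ^ K)))
    {S : Set (HeightOneSpectrum (𝓞 ℚ))} (hvS : v ∉ S) :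
    v ∈ frobeniusClassPrimes (W.torsionGaloisModule n) S τ (p ^ K) := by
  subst hn
  exact mem_frobeniusClassPrimes_of_kolyvaginPrime W p ℓ hℓp hgoodℓ hv hK hℓ1 hflag hdvd hsurj hτμ
    hτq hvS

/-- **`ℤ`-modulus spelling** of `exists_frobenius_shape`: a Frobenius at a Kolyvagin prime with
the cyclicity flag is an admissible `τ` for Sakamoto at level `p^K` ((H.2) and `τ ∈ Γ_{ℚ(μ_{p^K})}`).
[cite: Sakamoto2024, §2 (H.2) (p. 921)] -/
theorem exists_frobenius_shape' (W : WeierstrassCurve ℚ) [W.IsElliptic] [W.IsGloballyMinimal]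
    (p ℓ : ℕ) [Fact p.Prime] [Fact ℓ.Prime] (hℓp : ℓ ≠ p)
    (hgoodℓ : W.HasGoodReductionAtPrime ℓ) {v : HeightOneSpectrum (𝓞 ℚ)}
    (hv : (ℓ : 𝓞 ℚ) ∈ v.asIdeal) {K : ℕ} (hK : 0 < K) (hℓ1 : ℓ ≡ 1 [MOD p ^ K])
    (hflag : Nat.card (AddSubgroup.torsionBy (W.reductionAt v).toAffine.Point (p : ℕ)) ≤ p)
    (hdvd : p ^ K ∣ W.reductionPointCount ℓ) (n : ℤ) (hn : n = ((p ^ K : ℕ) : ℤ)) :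
    ∃ σ₀ : absoluteGaloisGroup ℚ, IsArithFrobAtPlace ℚ v σ₀ ∧ σ₀ ∈ rootsOfUnityFixer ℚ (p ^ K) ∧
      Nonempty (cokerSubOne (W.torsionGaloisModule n) σ₀ ≃+ ZMod (p ^ K)) := by
  subst hn
  obtain ⟨σ₀, 𝔓₀, h𝔓₀, hσ₀, hμ, -, -, hco⟩ :=
    exists_frobenius_shape W p ℓ hℓp hgoodℓ hv hK hℓ1 hflag hdvd
  exact ⟨σ₀, ⟨𝔓₀, h𝔓₀, hσ₀⟩, hμ, hco⟩

end Summit.BirchSwinnertonDyer.Rank1Residual.GaloisImage.FrobShape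

end
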